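import Summits.ResolutionOfSingularities.ResolutionOfSingularities.Theorems.EquisingularLiftEquisingularLiftNatNDChartBlowup
import Summits.ResolutionOfSingularities.ResolutionOfSingularities.Theorems.EquisingularLiftEquisingularLiftNatNDFanStarBasics
import HarnessLib

/-!
# [OURS · L1 W4.5(b) · EL♮(3) · ND-K5 (B4α1s)] THE STAR-CHART MATRIX `starChart B J i₀`: determinant, rays, cone, membership in `star Φ τ`

WIDTH helper for the ND-K5 brick (B4α1s) `modelStep` (res-L1-w45b-idea-1's spec §13.14 `ND.ToricStage` / `ND.ModelStep`), `--supports
stmt-ResolutionOfSingularities-20148`, no claim, counted 0 (res-L1-w45b-stub-4 g11).  AI-produced kernel work weaker than expert review; no statement of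
[Hironaka2017] is used; EL♮(3) is NOT proved here.

WHAT (over res-L1-w45b-lead-2's `starChart` of `…NatNDChartBlowup` and res-L1-w45b-iso-w3's `…NatNDFanStarBasics`).  `det (starChart B J i₀) = det B`
for `i₀ ∈ J` (row `i₀ += Σ_{J ∖ i₀}` of the other rows: `det_updateRow_add_finset_sum`, `det_zMat_starChart`, `isUnit_det_zMat_starChart`); the new row
as a ray is `Σ_{j ∈ J} (row j)` (`rayOf_finset_sum`, `rayOf_starChart_self`); the rays of the star chart are `insert (Σ_J rows) (old rays ∖ row i₀)`
(`image_rayOf_starChart`); a face `τ` of the chart cone is the image of its index set `J_τ = {j | row j ∈ τ}` with `Σ τ = Σ_{J_τ} rows`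
(`face_eq_image_filter`, `sum_face_eq_sum_rayOf`); hence **the star chart's cone lies in `star Φ τ`** (`image_rayOf_starChart_mem_star`); and the new
ray `Σ τ` is NOT a ray of the old smooth cone as soon as `τ` has two distinct rays (`sum_face_notMem_of_isSmoothCone`, by the dual vectors of
`exists_dual_of_isSmoothCone`).
-/

set_option linter.dupNamespace false

noncomputable section

open MvPolynomial

namespace Summit.ResolutionOfSingularities.ResolutionOfSingularities.Cruxes.EquisingularLiftNat.Sections.ND

variable {n : ℕ}

/-- `rayOf` is additive over finite sums of rows. [OURS · elementary] -/
theorem rayOf_finset_sum (B : Fin n → Fin n → ℕ) (J : Finset (Fin n)) :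
    rayOf (fun l => ∑ j ∈ J, B j l) = ∑ j ∈ J, rayOf (B j) := by
  funext l
  simp only [rayOf, Nat.cast_sum, Finset.sum_apply]

/-- The new row of the star chart as a ray: `Σ_{j ∈ J} (row j)`. [OURS · elementary] -/
theorem rayOf_starChart_self (B : Fin n → Fin n → ℕ) (J : Finset (Fin n)) (i₀ : Fin n) :
    rayOf (starChart B J i₀ i₀) = ∑ j ∈ J, rayOf (B j) := by
  rw [starChart_self, rayOf_finset_sum]

/-- Adding a sum of OTHER rows to a row does not change the determinant. [OURS · elementary] -/
theorem det_updateRow_add_finset_sum {R : Type*} [CommRing R] (A : Matrix (Fin n) (Fin n) R) (i₀ : Fin n) (s : Finset (Fin n)) (hs : i₀ ∉ s) :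
    (A.updateRow i₀ (A i₀ + ∑ j ∈ s, A j)).det = A.det := by
  classical
  induction s using Finset.induction_on with
  | empty => rw [Finset.sum_empty, add_zero, Matrix.updateRow_eq_self]
  | insert j s hj ih =>
    have hji : i₀ ≠ j := fun h => hs (h ▸ Finset.mem_insert_self _ _)
    have hs' : i₀ ∉ s := fun h => hs (Finset.mem_insert_of_mem h)
    set A' := A.updateRow i₀ (A i₀ + ∑ j ∈ s, A j) with hA'
    have hrow : A.updateRow i₀ (A i₀ + ∑ j ∈ insert j s, A j) = A'.updateRow i₀ (A' i₀ + A' j) := by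
      rw [Finset.sum_insert hj, hA', Matrix.updateRow_self, Matrix.updateRow_ne hji.symm]
      funext i
      by_cases hi : i = i₀
      · subst hi; simp only [Matrix.updateRow_self]; abel
      · simp only [Matrix.updateRow_ne hi]
    rw [hrow, Matrix.det_updateRow_add_self A' hji, ih hs']

/-- **The star chart is unimodular iff the old chart is**: `det (starChart B J i₀) = det B` for `i₀ ∈ J`. [OURS · elementary] -/
theorem det_zMat_starChart (B : Fin n → Fin n → ℕ) (J : Finset (Fin n)) {i₀ : Fin n} (hi₀ : i₀ ∈ J) :
    (zMat (starChart B J i₀)).det = (zMat B).det := by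
  classical
  have h : zMat (starChart B J i₀) = (zMat B).updateRow i₀ ((zMat B) i₀ + ∑ j ∈ J.erase i₀, (zMat B) j) := by
    ext i l
    by_cases hi : i = i₀
    · subst hi
      rw [Matrix.updateRow_self, zMat, Matrix.of_apply, starChart_self]
      simp only [Nat.cast_sum, Pi.add_apply, Finset.sum_apply, zMat, Matrix.of_apply]
      rw [← Finset.add_sum_erase J _ hi₀]
    · rw [Matrix.updateRow_ne hi, zMat, Matrix.of_apply, starChart_of_ne B J hi, zMat, Matrix.of_apply]
  rw [h, det_updateRow_add_finset_sum _ _ _ (Finset.notMem_erase i₀ J)]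

/-- The star chart is unimodular if the old chart is. [OURS · elementary] -/
theorem isUnit_det_zMat_starChart (B : Fin n → Fin n → ℕ) (hB : IsUnit (zMat B).det) (J : Finset (Fin n)) {i₀ : Fin n} (hi₀ : i₀ ∈ J) :
    IsUnit (zMat (starChart B J i₀)).det := by
  rw [det_zMat_starChart B J hi₀]; exact hB

/-- The rays of the star chart: the new ray `Σ_J` replaces the ray of row `i₀`. [OURS · elementary] -/
theorem image_rayOf_starChart (B : Fin n → Fin n → ℕ) (hB : IsUnit (zMat B).det) (J : Finset (Fin n)) (i₀ : Fin n) :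
    Finset.univ.image (fun i => rayOf (starChart B J i₀ i)) =
      insert (∑ j ∈ J, rayOf (B j)) ((Finset.univ.image (fun i => rayOf (B i))).erase (rayOf (B i₀))) := by
  classical
  have hinj := rayOf_injective_of_isUnit B hB
  ext ρ
  simp only [Finset.mem_image, Finset.mem_univ, true_and, Finset.mem_insert, Finset.mem_erase]
  constructor
  · rintro ⟨i, rfl⟩
    by_cases hi : i = i₀
    · subst hi; exact Or.inl (rayOf_starChart_self B J i)
    · rw [starChart_of_ne B J hi]
      exact Or.inr ⟨fun h => hi (hinj h), i, rfl⟩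
  · rintro (rfl | ⟨hne, i, rfl⟩)
    · exact ⟨i₀, rayOf_starChart_self B J i₀⟩
    · have hi : i ≠ i₀ := fun h => hne (h ▸ rfl)
      exact ⟨i, by rw [starChart_of_ne B J hi]⟩

/-- The index set of a face inside a chart cone and the sum of the face's rays. [OURS · elementary] -/
theorem sum_face_eq_sum_rayOf (B : Fin n → Fin n → ℕ) (hB : IsUnit (zMat B).det) {τ : Finset (Ray n)}
    (hτ : τ ⊆ Finset.univ.image (fun i => rayOf (B i))) :
    (∑ ρ ∈ τ, ρ) = ∑ j ∈ Finset.univ.filter (fun j => rayOf (B j) ∈ τ), rayOf (B j) := by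
  classical
  have hinj := rayOf_injective_of_isUnit B hB
  have hτeq : τ = (Finset.univ.filter (fun j => rayOf (B j) ∈ τ)).image (fun i => rayOf (B i)) := by
    ext ρ
    simp only [Finset.mem_image, Finset.mem_filter, Finset.mem_univ, true_and]
    constructor
    · intro hρ
      obtain ⟨i, -, rfl⟩ := Finset.mem_image.mp (hτ hρ)
      exact ⟨i, hρ, rfl⟩
    · rintro ⟨i, hi, rfl⟩; exact hi
  conv_lhs => rw [hτeq]
  rw [Finset.sum_image fun i _ j _ h => hinj h]

/-- The face is the image of its index set. [OURS · elementary] -/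
theorem face_eq_image_filter (B : Fin n → Fin n → ℕ) {τ : Finset (Ray n)} (hτ : τ ⊆ Finset.univ.image (fun i => rayOf (B i))) :
    τ = (Finset.univ.filter (fun j => rayOf (B j) ∈ τ)).image (fun i => rayOf (B i)) := by
  classical
  ext ρ
  simp only [Finset.mem_image, Finset.mem_filter, Finset.mem_univ, true_and]
  constructor
  · intro hρ
    obtain ⟨i, -, rfl⟩ := Finset.mem_image.mp (hτ hρ)
    exact ⟨i, hρ, rfl⟩
  · rintro ⟨i, hi, rfl⟩; exact hi

/-- The cone of the star chart lies in the starred fan. [OURS · elementary] -/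
theorem image_rayOf_starChart_mem_star (B : Fin n → Fin n → ℕ) (hB : IsUnit (zMat B).det) {Φ : Finset (Finset (Ray n))}
    (hσ : Finset.univ.image (fun i => rayOf (B i)) ∈ Φ) {τ : Finset (Ray n)} (hτ : τ ⊆ Finset.univ.image (fun i => rayOf (B i)))
    {i₀ : Fin n} (hi₀ : rayOf (B i₀) ∈ τ) :
    Finset.univ.image (fun i => rayOf (starChart B (Finset.univ.filter (fun j => rayOf (B j) ∈ τ)) i₀ i)) ∈ star Φ τ := by
  classical
  rw [mem_star_iff]
  refine Or.inr ⟨_, hσ, hτ, rayOf (B i₀), hi₀, ?_⟩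
  rw [image_rayOf_starChart B hB, sum_face_eq_sum_rayOf B hB hτ]

/-- **The new ray is not a ray of the old cone** when the face has two distinct rays (smooth cone: dual vectors). [OURS · elementary] -/
theorem sum_face_notMem_of_isSmoothCone {σ τ : Finset (Ray n)} (hσ : IsSmoothCone σ) (hτσ : τ ⊆ σ)
    (h2 : ∃ ρ₁ ∈ τ, ∃ ρ₂ ∈ τ, ρ₁ ≠ ρ₂) : (∑ ρ ∈ τ, ρ) ∉ σ := by
  classical
  intro hmem
  obtain ⟨ρ₁, h₁, ρ₂, h₂, hne⟩ := h2
  -- pick `t ∈ τ` different from the sum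
  obtain ⟨t, ht, hts⟩ : ∃ t ∈ τ, t ≠ ∑ ρ ∈ τ, ρ := by
    by_cases h : ρ₁ = ∑ ρ ∈ τ, ρ
    · exact ⟨ρ₂, h₂, fun h' => hne (h.trans h'.symm)⟩
    · exact ⟨ρ₁, h₁, h⟩
  obtain ⟨w, hw1, hw0⟩ := exists_dual_of_isSmoothCone hσ (hτσ ht)
  have h1 : w ⬝ᵥ (∑ ρ ∈ τ, ρ) = 1 := by
    rw [dotProduct_finset_sum]; exact sum_dual_eq_one hτσ ht hw1 hw0
  have h0 : w ⬝ᵥ (∑ ρ ∈ τ, ρ) = 0 := hw0 _ hmem (Ne.symm hts)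
  rw [h0] at h1
  exact zero_ne_one h1

end Summit.ResolutionOfSingularities.ResolutionOfSingularities.Cruxes.EquisingularLiftNat.Sections.ND

end
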